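import Summits.ValiantsHypothesis.ValiantsHypothesis.Theorems.RigidityForcesSymmetryRankRigidMinimalReprLaplaceResidualSupportLemma
import Summits.ValiantsHypothesis.ValiantsHypothesis.Theorems.RigidityForcesSymmetryRankRigidMinimalReprLaplaceResidualTools
import Literature.Computability.AlgebraicComplexity.RankOneDeterminantalExpressionsProofs

/-!
# The fibre sum of the two-slot expansion IS the `3 × 3` permanent on the complementary letters; LEMMA Z in fibre-sum form
# (crux `RankRigidMinimalRepr`, stmt-ValiantsHypothesis-18034; frontier rung `LaplaceOptimalFive`, stmt-24813)

FILE 2a of the `a = 3` residual blueprint (val-lit-p8 g11, `NOTE-p8g11-24813-a3-class-residual4.md` §v3: «lemma Z … needs the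
explicit fibre-sum formula»; val-lit desk RULING #258 (a); seat val-port-2).  The landed two-slot expansion
`LaplaceResidual.permanent_two_slot` (p614067) writes the `5 × 5` permanent in covector format as
`Σ_{x,y} φ₃(x) · F(x,y) · φ₄(y)` with the FIBRE SUM `F(x,y) = Σ_{σ : σ 3 = x, σ 4 = y} φ₀(σ0) φ₁(σ1) φ₂(σ2)` over `Equiv.Perm (Fin 5)`.
Here:
* `fibreSum_relabel` — relabelling the letters by a permutation `σ` moves the fibre: `F_{φ∘σ}(x,y) = F_φ(σ x, σ y)`;
* **`fibreSum_eq_permanent_three`** — for `x` and `y = x.succAbove y'` (every ordered pair of distinct letters has this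
  form) the fibre sum is the `3 × 3` permanent of `(φ₀;φ₁;φ₂)` on the three remaining letters
  `ℓ_r = x.succAbove (y'.succAbove r)`, `r = 0,1,2`, in the explicit form
  `φ₀(ℓ₀)(φ₁(ℓ₁)φ₂(ℓ₂) + φ₁(ℓ₂)φ₂(ℓ₁)) + φ₀(ℓ₁)(…) + φ₀(ℓ₂)(…)` — proved by feeding indicator covectors into the two-slot
  expansion and evaluating the resulting permanent by two Laplace expansions (`permanent_laplace_col_zero`,
  `permanent_fin_three` of `Literature/…/RankOneDeterminantalExpressionsProofs`) after a slot rotation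
  (`Matrix.permanent_permute_rows`);
* **`pairPerm_eq_zero_of_fibreSum_eq_zero`** — LEMMA Z in the two-slot currency: if `φ₀` has full support and the
  fibre sums `F(x,y)` vanish for all `x ≠ y` (i.e. the bilinear form of the two-slot expansion is ZERO), then all `2 × 2`
  permanents `φ₁(a)φ₂(b) + φ₁(b)φ₂(a)`, `a ≠ b`, vanish (pair `{0,1}` from the ten sorted instances of the bridge and
  `six_mul_pairPerm_eq_combination` of FILE 1, every pair by `exists_perm_apply_zero_one` + `fibreSum_relabel`).
No definitions.  HONEST FRAMING: elementary helper lemmas toward the frontier rung `LaplaceOptimalFive` (stmt-24813),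
which stays OPEN (as do 24814 and the crux 18034); nothing here bears on `VP ≠ VNP`. [folklore]
-/

set_option autoImplicit false

-- the mandated summit-side namespace repeats a component by design (single-problem summit)
set_option linter.dupNamespace false

namespace Summit.ValiantsHypothesis.ValiantsHypothesis.Theorems.RigidityForcesSymmetryRankRigidMinimalRepr

namespace LaplaceResidual

open Finset
open Literature.Computability.AlgebraicComplexity (permanent_laplace_col_zero permanent_fin_three)

/-! ### §1 Relabelling the fibre sum -/

/-- Relabelling the letters by `σ` moves the fibre: `F_{φ ∘ σ}(x, y) = F_φ(σ x, σ y)`. [folklore] -/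
theorem fibreSum_relabel (φ : Fin 5 → Fin 5 → ℂ) (σ : Equiv.Perm (Fin 5)) (x y : Fin 5) :
    (∑ τ : Equiv.Perm (Fin 5),
        if τ 3 = x ∧ τ 4 = y then φ 0 (σ (τ 0)) * φ 1 (σ (τ 1)) * φ 2 (σ (τ 2)) else 0) =
      ∑ τ : Equiv.Perm (Fin 5),
        if τ 3 = σ x ∧ τ 4 = σ y then φ 0 (τ 0) * φ 1 (τ 1) * φ 2 (τ 2) else 0 := by
  refine Fintype.sum_equiv (Equiv.mulLeft σ) _ _ (fun τ => ?_)
  simp only [Equiv.coe_mulLeft, Equiv.Perm.mul_apply, σ.injective.eq_iff]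

/-! ### §2 The fibre sum is the `3 × 3` permanent on the complementary letters -/

/-- The slot rotation `(0,1,2,3,4) ↦ (3,4,0,1,2)` used to bring the two indicator slots to the front. -/
private theorem rot_bij : Function.LeftInverse (![2, 3, 4, 0, 1] : Fin 5 → Fin 5) ![3, 4, 0, 1, 2] ∧
    Function.RightInverse (![2, 3, 4, 0, 1] : Fin 5 → Fin 5) ![3, 4, 0, 1, 2] := by
  constructor <;> decide

/-- **The fibre-sum formula.**  For letters `x` and `y = x.succAbove y'`, the fibre sum of the two-slot expansion is the
`3 × 3` permanent of `(φ₀; φ₁; φ₂)` on the three remaining letters `ℓ_r = x.succAbove (y'.succAbove r)`: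
`Σ_{σ 3 = x, σ 4 = y} φ₀(σ0)φ₁(σ1)φ₂(σ2) = φ₀(ℓ₀)(φ₁(ℓ₁)φ₂(ℓ₂) + φ₁(ℓ₂)φ₂(ℓ₁)) + φ₀(ℓ₁)(φ₁(ℓ₀)φ₂(ℓ₂) + φ₁(ℓ₂)φ₂(ℓ₀))
 + φ₀(ℓ₂)(φ₁(ℓ₀)φ₂(ℓ₁) + φ₁(ℓ₁)φ₂(ℓ₀))`. [folklore] -/
theorem fibreSum_eq_permanent_three (φ : Fin 5 → Fin 5 → ℂ) (x : Fin 5) (y' : Fin 4) :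
    (∑ τ : Equiv.Perm (Fin 5),
        if τ 3 = x ∧ τ 4 = x.succAbove y' then φ 0 (τ 0) * φ 1 (τ 1) * φ 2 (τ 2) else 0) =
      φ 0 (x.succAbove (y'.succAbove 0)) *
          (φ 1 (x.succAbove (y'.succAbove 1)) * φ 2 (x.succAbove (y'.succAbove 2)) +
            φ 1 (x.succAbove (y'.succAbove 2)) * φ 2 (x.succAbove (y'.succAbove 1))) +
        φ 0 (x.succAbove (y'.succAbove 1)) *
          (φ 1 (x.succAbove (y'.succAbove 0)) * φ 2 (x.succAbove (y'.succAbove 2)) +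
            φ 1 (x.succAbove (y'.succAbove 2)) * φ 2 (x.succAbove (y'.succAbove 0))) +
        φ 0 (x.succAbove (y'.succAbove 2)) *
          (φ 1 (x.succAbove (y'.succAbove 0)) * φ 2 (x.succAbove (y'.succAbove 1)) +
            φ 1 (x.succAbove (y'.succAbove 1)) * φ 2 (x.succAbove (y'.succAbove 0))) := by
  classical
  set y : Fin 5 := x.succAbove y' with hy
  -- indicator covectors in slots 3 and 4
  let ψ : Fin 5 → Fin 5 → ℂ := fun s =>
    if s = 3 then (fun c => if c = x then 1 else 0) else if s = 4 then (fun c => if c = y then 1 else 0) else φ s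
  have hψ0 : ψ 0 = φ 0 := by simp [ψ]
  have hψ1 : ψ 1 = φ 1 := by simp [ψ]
  have hψ2 : ψ 2 = φ 2 := by simp [ψ]
  have hψ3 : ψ 3 = fun c => if c = x then 1 else 0 := by simp [ψ]
  have hψ4 : ψ 4 = fun c => if c = y then 1 else 0 := by simp [ψ]
  -- the two-slot expansion at `ψ` collapses to the fibre sum at `(x, y)`
  have two := permanent_two_slot ψ
  rw [hψ0, hψ1, hψ2, hψ3, hψ4] at two
  simp only [boole_mul, ← ite_and, mul_boole] at two
  rw [Finset.sum_eq_single x (fun b _ hb => by simp [hb]) (fun h => absurd (mem_univ _) h)] at two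
  rw [Finset.sum_eq_single y (fun b _ hb => by simp [hb]) (fun h => absurd (mem_univ _) h)] at two
  simp only [and_self, if_true] at two
  rw [← two]
  -- evaluate the permanent of the matrix with indicator columns in slots 3, 4: rotate the slots to the front
  let ρ : Equiv.Perm (Fin 5) := ⟨![3, 4, 0, 1, 2], ![2, 3, 4, 0, 1], rot_bij.1, rot_bij.2⟩
  have hρ0 : ρ 0 = 3 := rfl
  have hρ1 : ρ 1 = 4 := rfl
  have hρ2 : ρ 2 = 0 := rfl
  have hρ3 : ρ 3 = 1 := rfl
  have hρ4 : ρ 4 = 2 := rfl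
  rw [← Matrix.permanent_permute_rows ρ]
  -- first Laplace expansion (column 0 = slot 3 = indicator of `x`)
  rw [permanent_laplace_col_zero]
  have hcol0 : ∀ i : Fin 5, (Matrix.of fun c s => ψ s c).submatrix id ρ i 0 = if i = x then 1 else 0 := by
    intro i; simp [Matrix.submatrix_apply, hρ0, hψ3]
  simp only [hcol0, boole_mul]
  rw [Finset.sum_ite_eq' univ x, if_pos (mem_univ _)]
  -- second Laplace expansion (new column 0 = slot 4 = indicator of `y`)
  rw [permanent_laplace_col_zero]
  have hcol1 : ∀ i : Fin 4, ((Matrix.of fun c s => ψ s c).submatrix id ρ).submatrix x.succAbove Fin.succ i 0 =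
      if i = y' then 1 else 0 := by
    intro i
    simp only [Matrix.submatrix_apply, id, Fin.succ_zero_eq_one, hρ1, Matrix.of_apply, hψ4, hy,
      Fin.succAbove_right_inj]
  simp only [hcol1, boole_mul]
  rw [Finset.sum_ite_eq' univ y', if_pos (mem_univ _)]
  -- the remaining `3 × 3` permanent
  rw [permanent_fin_three]
  have h2 : ρ (Fin.succ (Fin.succ (0 : Fin 3))) = 0 := rfl
  have h3 : ρ (Fin.succ (Fin.succ (1 : Fin 3))) = 1 := rfl
  have h4 : ρ (Fin.succ (Fin.succ (2 : Fin 3))) = 2 := rfl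
  simp only [Matrix.submatrix_apply, id, Matrix.of_apply, h2, h3, h4, hψ0, hψ1, hψ2]

/-! ### §3 LEMMA Z in fibre-sum form -/

/-- The pair `{0,1}` from the vanishing of the ten fibre sums whose complementary letters are the ten triples
(`six_mul_pairPerm_eq_combination` of FILE 1). [folklore] -/
theorem pairPerm_zero_one_eq_zero_of_fibreSum (φ : Fin 5 → Fin 5 → ℂ) (h0 : ∀ c, φ 0 c ≠ 0)
    (hF : ∀ x y : Fin 5, x ≠ y →
      (∑ τ : Equiv.Perm (Fin 5), if τ 3 = x ∧ τ 4 = y then φ 0 (τ 0) * φ 1 (τ 1) * φ 2 (τ 2) else 0) = 0) :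
    φ 1 0 * φ 2 1 + φ 1 1 * φ 2 0 = 0 := by
  -- the ten triples `T`, each as the complement of `(x, x.succAbove y')`
  have h234 := fibreSum_eq_permanent_three φ 0 0   -- complement {2,3,4}
  have h134 := fibreSum_eq_permanent_three φ 0 1   -- y = 2: complement {1,3,4}
  have h124 := fibreSum_eq_permanent_three φ 0 2   -- y = 3: complement {1,2,4}
  have h123 := fibreSum_eq_permanent_three φ 0 3   -- y = 4: complement {1,2,3}
  have h034 := fibreSum_eq_permanent_three φ 1 1   -- x = 1, y = 2: complement {0,3,4}
  have h024 := fibreSum_eq_permanent_three φ 1 2   -- x = 1, y = 3: complement {0,2,4}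
  have h023 := fibreSum_eq_permanent_three φ 1 3   -- x = 1, y = 4: complement {0,2,3}
  have h014 := fibreSum_eq_permanent_three φ 2 2   -- x = 2, y = 3: complement {0,1,4}
  have h013 := fibreSum_eq_permanent_three φ 2 3   -- x = 2, y = 4: complement {0,1,3}
  have h012 := fibreSum_eq_permanent_three φ 3 3   -- x = 3, y = 4: complement {0,1,2}
  rw [hF 0 ((0 : Fin 5).succAbove 0) (by decide)] at h234
  rw [hF 0 ((0 : Fin 5).succAbove 1) (by decide)] at h134
  rw [hF 0 ((0 : Fin 5).succAbove 2) (by decide)] at h124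
  rw [hF 0 ((0 : Fin 5).succAbove 3) (by decide)] at h123
  rw [hF 1 ((1 : Fin 5).succAbove 1) (by decide)] at h034
  rw [hF 1 ((1 : Fin 5).succAbove 2) (by decide)] at h024
  rw [hF 1 ((1 : Fin 5).succAbove 3) (by decide)] at h023
  rw [hF 2 ((2 : Fin 5).succAbove 2) (by decide)] at h014
  rw [hF 2 ((2 : Fin 5).succAbove 3) (by decide)] at h013
  rw [hF 3 ((3 : Fin 5).succAbove 3) (by decide)] at h012
  simp only [show ((0 : Fin 5).succAbove ((0 : Fin 4).succAbove 0)) = 2 by decide,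
    show ((0 : Fin 5).succAbove ((0 : Fin 4).succAbove 1)) = 3 by decide,
    show ((0 : Fin 5).succAbove ((0 : Fin 4).succAbove 2)) = 4 by decide,
    show ((0 : Fin 5).succAbove ((1 : Fin 4).succAbove 0)) = 1 by decide,
    show ((0 : Fin 5).succAbove ((1 : Fin 4).succAbove 1)) = 3 by decide,
    show ((0 : Fin 5).succAbove ((1 : Fin 4).succAbove 2)) = 4 by decide,
    show ((0 : Fin 5).succAbove ((2 : Fin 4).succAbove 0)) = 1 by decide,
    show ((0 : Fin 5).succAbove ((2 : Fin 4).succAbove 1)) = 2 by decide,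
    show ((0 : Fin 5).succAbove ((2 : Fin 4).succAbove 2)) = 4 by decide,
    show ((0 : Fin 5).succAbove ((3 : Fin 4).succAbove 0)) = 1 by decide,
    show ((0 : Fin 5).succAbove ((3 : Fin 4).succAbove 1)) = 2 by decide,
    show ((0 : Fin 5).succAbove ((3 : Fin 4).succAbove 2)) = 3 by decide,
    show ((1 : Fin 5).succAbove ((1 : Fin 4).succAbove 0)) = 0 by decide,
    show ((1 : Fin 5).succAbove ((1 : Fin 4).succAbove 1)) = 3 by decide,
    show ((1 : Fin 5).succAbove ((1 : Fin 4).succAbove 2)) = 4 by decide,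
    show ((1 : Fin 5).succAbove ((2 : Fin 4).succAbove 0)) = 0 by decide,
    show ((1 : Fin 5).succAbove ((2 : Fin 4).succAbove 1)) = 2 by decide,
    show ((1 : Fin 5).succAbove ((2 : Fin 4).succAbove 2)) = 4 by decide,
    show ((1 : Fin 5).succAbove ((3 : Fin 4).succAbove 0)) = 0 by decide,
    show ((1 : Fin 5).succAbove ((3 : Fin 4).succAbove 1)) = 2 by decide,
    show ((1 : Fin 5).succAbove ((3 : Fin 4).succAbove 2)) = 3 by decide,
    show ((2 : Fin 5).succAbove ((2 : Fin 4).succAbove 0)) = 0 by decide,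
    show ((2 : Fin 5).succAbove ((2 : Fin 4).succAbove 1)) = 1 by decide,
    show ((2 : Fin 5).succAbove ((2 : Fin 4).succAbove 2)) = 4 by decide,
    show ((2 : Fin 5).succAbove ((3 : Fin 4).succAbove 0)) = 0 by decide,
    show ((2 : Fin 5).succAbove ((3 : Fin 4).succAbove 1)) = 1 by decide,
    show ((2 : Fin 5).succAbove ((3 : Fin 4).succAbove 2)) = 3 by decide,
    show ((3 : Fin 5).succAbove ((3 : Fin 4).succAbove 0)) = 0 by decide,
    show ((3 : Fin 5).succAbove ((3 : Fin 4).succAbove 1)) = 1 by decide,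
    show ((3 : Fin 5).succAbove ((3 : Fin 4).succAbove 2)) = 2 by decide] at h234 h134 h124 h123 h034 h024 h023 h014 h013 h012
  have key : 6 * (φ 0 2 * φ 0 3 * φ 0 4) * (φ 1 0 * φ 2 1 + φ 1 1 * φ 2 0) = 0 := by
    rw [six_mul_pairPerm_eq_combination]
    linear_combination (-(2 * φ 0 3 * φ 0 4)) * h012 + (-(2 * φ 0 2 * φ 0 4)) * h013 +
      (-(2 * φ 0 2 * φ 0 3)) * h014 + (φ 0 1 * φ 0 4) * h023 + (φ 0 1 * φ 0 3) * h024 + (φ 0 1 * φ 0 2) * h034 +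
      (φ 0 0 * φ 0 4) * h123 + (φ 0 0 * φ 0 3) * h124 + (φ 0 0 * φ 0 2) * h134 + (-(2 * φ 0 0 * φ 0 1)) * h234
  have hne : (6 : ℂ) * (φ 0 2 * φ 0 3 * φ 0 4) ≠ 0 :=
    mul_ne_zero (by norm_num) (mul_ne_zero (mul_ne_zero (h0 2) (h0 3)) (h0 4))
  rcases mul_eq_zero.1 key with h | h
  · exact absurd h hne
  · exact h

/-- **LEMMA Z in the two-slot currency.**  If `φ₀` has full support and the bilinear form of the two-slot expansion
vanishes — every fibre sum `F(x,y) = Σ_{σ 3 = x, σ 4 = y} φ₀(σ0)φ₁(σ1)φ₂(σ2)`, `x ≠ y`, is `0` — then every `2 × 2`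
permanent of `(φ₁; φ₂)` vanishes: `φ₁(a)φ₂(b) + φ₁(b)φ₂(a) = 0` for `a ≠ b`. [folklore] -/
theorem pairPerm_eq_zero_of_fibreSum_eq_zero (φ : Fin 5 → Fin 5 → ℂ) (h0 : ∀ c, φ 0 c ≠ 0)
    (hF : ∀ x y : Fin 5, x ≠ y →
      (∑ τ : Equiv.Perm (Fin 5), if τ 3 = x ∧ τ 4 = y then φ 0 (τ 0) * φ 1 (τ 1) * φ 2 (τ 2) else 0) = 0)
    (a b : Fin 5) (hab : a ≠ b) : φ 1 a * φ 2 b + φ 1 b * φ 2 a = 0 := by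
  obtain ⟨σ, hσ0, hσ1⟩ := exists_perm_apply_zero_one a b hab
  have h := pairPerm_zero_one_eq_zero_of_fibreSum (fun s => φ s ∘ σ) (fun c => h0 (σ c))
    (fun x y hxy => by
      simp only [Function.comp_apply]
      rw [fibreSum_relabel φ σ x y]
      exact hF (σ x) (σ y) (σ.injective.ne hxy))
  simpa only [Function.comp_apply, hσ0, hσ1] using h

end LaplaceResidual

end Summit.ValiantsHypothesis.ValiantsHypothesis.Theorems.RigidityForcesSymmetryRankRigidMinimalRepr
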